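import Summits.BirchSwinnertonDyer.BirchSwinnertonDyer.Theorems.PrintCFramBottomClassIndexLawFiveLeLevelCriterionExactLevel
import Summits.BirchSwinnertonDyer.Rank1Residual.Additive.AdditiveTorsionFiveSeven
import HarnessLib

/-!
# Route `PrintCFram`, crux C2 `BottomClassIndexLawFiveLe` (stmt-BirchSwinnertonDyer-20372), line `eisenstein-resource-bdp-line`:
# **THE LEVEL BINDER IN ELEMENTARY CURRENCY, IV — EVERY ADDITIVE PRIME `p ≥ 5` OFF MAZUR'S LOCUS (`p ≥ 11`: no side condition)**
# (cell `bsd-print-cfram`, width seat `bsd-line-cfram-p1-w6` g5; helper `--supports` 20372; 0 defs, 0 facts, 0 sorry; ROUTE-INDEPENDENT)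

HONEST FRAMING. Nothing about BSD is proved here and no stub is closed. The local hypothesis `W(ℚ_p)[p] = 0` of files I–III is automatic
at an additive prime `p ≥ 11`, and at `p = 5`, `7` off Mazur's locus `v₅(c₄) = 1` / `v₇(c₆) = 1` (tree:
`Rank1Residual.Additive.eq_zero_of_prime_nsmul_eq_zero_of_addv`, Mazur 1977 III.5 Step 1). Hence, for EVERY globally minimal `W/ℚ` with
ADDITIVE reduction at such a `p` and every rational point `P` with `12 • P = (x, y)` — not only on the CM-ramified class —:
**`ι P ∈ p^k W(ℚ_p) ⟺ p^{2k} ∣ den x`** (`k ≥ 1`), **the exact level is `v_p(den x)/2`**, **level `≥ 1 ⟺ p ∣ den x`** (the log-currency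
forms follow the same way from `…LevelCriterionLog.exists_pow_nsmul_eq_iff_norm_padicLog_le_of_addv`). Consumers: any additive rank-one lane whose binders are `p`-divisibility levels in
`W(ℚ_p)` (cells `bsd-addord`, `bsd-potss`, the `Addv` rows of `Rank1Residual`).

* `exists_pow_nsmul_eq_toPadicPoint_iff_pow_dvd_den_of_addv_offLocus`, `level_iff_padicValNat_den_eq_of_addv_offLocus`,
  `exists_prime_nsmul_eq_toPadicPoint_iff_dvd_den_of_addv_offLocus`;
* the `p ≥ 11` forms `…_of_eleven_le` (no side condition).

THEOREMS ONLY; no definition, no named fact, no `sorry`. BSD is not proved by any of this; no summit statement is proved by this seat.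
References: [SilvermanAEC2009] IV.6.4, VII.2.1–2.2, VII.6.1, VII.6.3; [Mazur1977] Ch. III §5, Step 1 (p. 158).
-/

set_option autoImplicit false
-- `…BirchSwinnertonDyer.BirchSwinnertonDyer.Theorems…` is the problem's mandated namespace (D-0017).
set_option linter.dupNamespace false

noncomputable section

open scoped Classical

namespace Summit.BirchSwinnertonDyer.BirchSwinnertonDyer.Theorems.PrintCFram.LevelCriterion

open WeierstrassCurve Literature.NumberTheory.EllipticCurves Literature.NumberTheory.EllipticCurves.Rank1Residual
open Summit.BirchSwinnertonDyer.Rank1Residual.Additive (eq_zero_of_prime_nsmul_eq_zero_of_addv)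

variable (W : WeierstrassCurve ℚ) [W.IsElliptic] [W.IsGloballyMinimal] (p : ℕ) [hp : Fact p.Prime]

/-! ## §1 Additive `p ≥ 5` off Mazur's locus (`p = 5 → v₅(c₄) ≠ 1`, `p = 7 → v₇(c₆) ≠ 1`) -/

/-- **`ι P ∈ p^k W(ℚ_p)` iff `p^{2k} ∣ den x(12 • P)`** (`k ≥ 1`) for EVERY globally minimal `W/ℚ` ADDITIVE at `p ≥ 5` off Mazur's locus.
[cite: SilvermanAEC2009, VII.2 Prop. 2.1–2.2, IV.6.4, VII.6.1, VII.6.3] [cite: Mazur1977, Ch. III §5, Step 1, p. 158] -/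
theorem exists_pow_nsmul_eq_toPadicPoint_iff_pow_dvd_den_of_addv_offLocus (hp5 : 5 ≤ p) (hadd : Addv W p)
    (h5 : p = 5 → padicValRat p W.c₄ ≠ 1) (h7 : p = 7 → padicValRat p W.c₆ ≠ 1)
    {P : W.toAffine.Point} {x y : ℚ} {hxy : W.toAffine.Nonsingular x y} (h12 : 12 • P = .some x y hxy)
    {k : ℕ} (hk : 1 ≤ k) :
    (∃ Q : (W.baseChange ℚ_[p]).toAffine.Point, p ^ k • Q = W.toPadicPoint p P) ↔ p ^ (2 * k) ∣ x.den :=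
  exists_pow_nsmul_eq_toPadicPoint_iff_pow_dvd_den W p hp5 hadd
    (fun _ hQ => eq_zero_of_prime_nsmul_eq_zero_of_addv W p hp5 hadd h5 h7 hQ) h12 hk

/-- **The exact level is `v_p(den x(12 • P))/2`** for every globally minimal `W/ℚ` additive at `p ≥ 5` off Mazur's locus.
[cite: SilvermanAEC2009, VII.2 Prop. 2.1–2.2, VII.6.3] [cite: Mazur1977, Ch. III §5, Step 1, p. 158] -/
theorem level_iff_padicValNat_den_eq_of_addv_offLocus (hp5 : 5 ≤ p) (hadd : Addv W p)
    (h5 : p = 5 → padicValRat p W.c₄ ≠ 1) (h7 : p = 7 → padicValRat p W.c₆ ≠ 1)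
    {P : W.toAffine.Point} {x y : ℚ} {hxy : W.toAffine.Nonsingular x y} (h12 : 12 • P = .some x y hxy) (n : ℕ) :
    ((∃ Q : (W.baseChange ℚ_[p]).toAffine.Point, p ^ n • Q = W.toPadicPoint p P) ∧
      (∀ Q : (W.baseChange ℚ_[p]).toAffine.Point, p ^ (n + 1) • Q ≠ W.toPadicPoint p P)) ↔
      padicValNat p x.den = 2 * n :=
  level_iff_padicValNat_den_eq W p hp5 hadd (fun _ hQ => eq_zero_of_prime_nsmul_eq_zero_of_addv W p hp5 hadd h5 h7 hQ) h12 n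

/-- **Level `≥ 1` iff `p ∣ den x(12 • P)`** for every globally minimal `W/ℚ` additive at `p ≥ 5` off Mazur's locus.
[cite: SilvermanAEC2009, VII.2 Prop. 2.1–2.2, VII.6.3] [cite: Mazur1977, Ch. III §5, Step 1, p. 158] -/
theorem exists_prime_nsmul_eq_toPadicPoint_iff_dvd_den_of_addv_offLocus (hp5 : 5 ≤ p) (hadd : Addv W p)
    (h5 : p = 5 → padicValRat p W.c₄ ≠ 1) (h7 : p = 7 → padicValRat p W.c₆ ≠ 1)
    {P : W.toAffine.Point} {x y : ℚ} {hxy : W.toAffine.Nonsingular x y} (h12 : 12 • P = .some x y hxy) :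
    (∃ Q : (W.baseChange ℚ_[p]).toAffine.Point, p • Q = W.toPadicPoint p P) ↔ p ∣ x.den :=
  exists_prime_nsmul_eq_toPadicPoint_iff_dvd_den W p hp5 hadd
    (fun _ hQ => eq_zero_of_prime_nsmul_eq_zero_of_addv W p hp5 hadd h5 h7 hQ) h12

/-! ## §2 Additive `p ≥ 11`: no side condition -/

/-- **`p ≥ 11` additive: `ι P ∈ p^k W(ℚ_p)` iff `p^{2k} ∣ den x(12 • P)`** (`k ≥ 1`), every globally minimal `W/ℚ`.
[cite: SilvermanAEC2009, VII.2 Prop. 2.1–2.2, VII.6.3] [cite: Mazur1977, Ch. III §5, Step 1, p. 158] -/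
theorem exists_pow_nsmul_eq_toPadicPoint_iff_pow_dvd_den_of_eleven_le (h11 : 11 ≤ p) (hadd : Addv W p)
    {P : W.toAffine.Point} {x y : ℚ} {hxy : W.toAffine.Nonsingular x y} (h12 : 12 • P = .some x y hxy)
    {k : ℕ} (hk : 1 ≤ k) :
    (∃ Q : (W.baseChange ℚ_[p]).toAffine.Point, p ^ k • Q = W.toPadicPoint p P) ↔ p ^ (2 * k) ∣ x.den :=
  exists_pow_nsmul_eq_toPadicPoint_iff_pow_dvd_den_of_addv_offLocus W p (by omega) hadd (fun h => by omega)
    (fun h => by omega) h12 hk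

/-- **`p ≥ 11` additive: the exact level is `v_p(den x(12 • P))/2`.** [cite: SilvermanAEC2009, VII.2 Prop. 2.1–2.2, VII.6.3]
[cite: Mazur1977, Ch. III §5, Step 1, p. 158] -/
theorem level_iff_padicValNat_den_eq_of_eleven_le (h11 : 11 ≤ p) (hadd : Addv W p)
    {P : W.toAffine.Point} {x y : ℚ} {hxy : W.toAffine.Nonsingular x y} (h12 : 12 • P = .some x y hxy) (n : ℕ) :
    ((∃ Q : (W.baseChange ℚ_[p]).toAffine.Point, p ^ n • Q = W.toPadicPoint p P) ∧
      (∀ Q : (W.baseChange ℚ_[p]).toAffine.Point, p ^ (n + 1) • Q ≠ W.toPadicPoint p P)) ↔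
      padicValNat p x.den = 2 * n :=
  level_iff_padicValNat_den_eq_of_addv_offLocus W p (by omega) hadd (fun h => by omega) (fun h => by omega) h12 n

/-- **`p ≥ 11` additive: level `≥ 1` iff `p ∣ den x(12 • P)`.** [cite: SilvermanAEC2009, VII.2 Prop. 2.1–2.2, VII.6.3]
[cite: Mazur1977, Ch. III §5, Step 1, p. 158] -/
theorem exists_prime_nsmul_eq_toPadicPoint_iff_dvd_den_of_eleven_le (h11 : 11 ≤ p) (hadd : Addv W p)
    {P : W.toAffine.Point} {x y : ℚ} {hxy : W.toAffine.Nonsingular x y} (h12 : 12 • P = .some x y hxy) :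
    (∃ Q : (W.baseChange ℚ_[p]).toAffine.Point, p • Q = W.toPadicPoint p P) ↔ p ∣ x.den :=
  exists_prime_nsmul_eq_toPadicPoint_iff_dvd_den_of_addv_offLocus W p (by omega) hadd (fun h => by omega)
    (fun h => by omega) h12

end Summit.BirchSwinnertonDyer.BirchSwinnertonDyer.Theorems.PrintCFram.LevelCriterion

end
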